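import Literature.Probability.LatticeModels.MedialPolygonWinding

set_option linter.unusedVariables false

/-!
# Two oriented medial arcs closed by a common path: turning difference = winding jump; a quadrant lemma
(line `qkz-strip-boundary-arm` of crux `CardyComplexCone.EdgePrecompact`, stmt-CriticalPhenomena-11387;
combinatorial core of the planar input `medialTwoArcSurround_ball` of the residual
`ufrs_slippedReturnCase_cert(J)` — the "slipped return" of the split branch of the UFRS arm domination)

Everything here lives on the oriented medial graph of `ℤ²` in medial coordinates
(`Literature.Probability.LatticeModels.MedialTrail`: `IsDart`, `cturn`, `wnd`, `dartWnd`, `lf`, `rf`,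
the combinatorial Umlaufsatz `inv_of_isTrail`). Three tools:

* `cturn_eq_four_mul_wnd_SR` — for a closed TRAIL `T` and ANY of its darts `d`,
  `cturn T = 4 · (wnd T (lf d) + wnd T (rf d))` (the two faces of `d` carry `{0, 1}` or `{-1, 0}`).
* `twoTrail_turn_sub_SR` — the OPEN-ARC Umlaufsatz in the closable case. Two closed trails
  `T₀ = (range (n₀ + L)).map Φ₀`, `T₁ = (range (n₁ + L)).map Φ₁` with the same first dart and a common
  tail of length `L` (the arcs `Φ₀ [0, n₀]`, `Φ₁ [0, n₁]` closed by ONE common path): the difference of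
  the turn sums of the two arcs is `4 ×` the difference of their `dartWnd`-sums over the two faces of
  the first dart (the common closing path cancels on both sides).
* `dwnd_eq_zero_of_NE_SR` & co. — QUADRANT LEMMA for closed dart chains (lists of unit-or-null steps
  with zero boundary): if no endpoint lies in the closed north-east (north-west, south-west,
  south-east) lattice quadrant at the face `F`, then `dwnd D F = 0` (walk from `F` straight north /
  south to infinity across segments that carry no step). Hence a chain winding around `F` has vertices
  in all four quadrants, so `F` lies in their convex hull — the form in which "nonzero winding number ⇒
  the polygon is far-reaching" is consumed.

References: H. Hopf, Compositio Math. 2 (1935), Satz I; S. Smirnov, Ann. of Math. 172 (2010), §4, Fig. 5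
(the oriented medial lattice).
-/

namespace Summit.CriticalPhenomena.CardyFormulaZ2.Cruxes.EdgePrecompact.QkzStripBoundaryArm

open Literature.Probability.LatticeModels Literature.Probability.LatticeModels.MedialTrail

/-! ## The turning number of a closed trail read off at one dart -/

/-- **(★)** For a closed trail of the oriented medial graph and any of its darts `d`, the turning
number is `4 · (wnd (lf d) + wnd (rf d))`: a positive trail has `wnd (lf d) = 1`, `wnd (rf d) = 0`, a
negative one `0` and `-1`. -/
theorem cturn_eq_four_mul_wnd_SR {l : List Pt} (hl : IsTrail l) {d : Pt × Pt} (hd : d ∈ cdarts l) :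
    cturn l = 4 * (wnd l (lf d) + wnd l (rf d)) := by
  rcases (inv_of_isTrail l hl).rf_cases hl hd with ⟨h1, h2, h3, -⟩ | ⟨h1, h2, h3, -⟩ <;> omega

/-- The winding number of the cyclic list of a `Q`-periodic sequence is the sum of the contributions
of its `Q` consecutive darts. -/
theorem wnd_map_range_SR (P : ℕ → Pt) {Q : ℕ} (hper : P Q = P 0) (F : Pt) :
    wnd ((List.range Q).map P) F = ∑ m ∈ Finset.range Q, dartWnd (P m, P (m + 1)) F := by
  rw [wnd, cdarts_map_range P hper, dwnd, List.map_map, ← List.sum_toFinset _ List.nodup_range, List.toFinset_range]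
  rfl

/-- **Open-arc Umlaufsatz, closable case.** Two closed trails given by periodic sequences `Φ₀`
(period `n₀ + L`) and `Φ₁` (period `n₁ + L`) with the same first dart `Φ₀ 0 → Φ₀ 1 = Φ₁ 0 → Φ₁ 1` and
a common tail `Φ₀ (n₀ + u) = Φ₁ (n₁ + u)`, `u ≤ L + 1`: the turn sums of the two initial arcs differ by
`4 ×` the difference of their winding contributions to the two faces of the first dart. -/
theorem twoTrail_turn_sub_SR (Φ₀ Φ₁ : ℕ → Pt) (n₀ n₁ L : ℕ) (hL : 1 ≤ L)
    (hT₀ : IsTrail ((List.range (n₀ + L)).map Φ₀)) (hT₁ : IsTrail ((List.range (n₁ + L)).map Φ₁))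
    (hper₀ : Φ₀ (n₀ + L) = Φ₀ 0) (hper₀' : Φ₀ (n₀ + L + 1) = Φ₀ 1)
    (hper₁ : Φ₁ (n₁ + L) = Φ₁ 0) (hper₁' : Φ₁ (n₁ + L + 1) = Φ₁ 1)
    (h0 : Φ₀ 0 = Φ₁ 0) (h1 : Φ₀ 1 = Φ₁ 1) (htail : ∀ u ≤ L + 1, Φ₀ (n₀ + u) = Φ₁ (n₁ + u)) :
    (∑ m ∈ Finset.range n₀, turn (Φ₀ m) (Φ₀ (m + 1)) (Φ₀ (m + 2))) -
        ∑ m ∈ Finset.range n₁, turn (Φ₁ m) (Φ₁ (m + 1)) (Φ₁ (m + 2)) =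
      4 * (((∑ m ∈ Finset.range n₀, dartWnd (Φ₀ m, Φ₀ (m + 1)) (lf (Φ₀ 0, Φ₀ 1))) -
              ∑ m ∈ Finset.range n₁, dartWnd (Φ₁ m, Φ₁ (m + 1)) (lf (Φ₀ 0, Φ₀ 1))) +
            ((∑ m ∈ Finset.range n₀, dartWnd (Φ₀ m, Φ₀ (m + 1)) (rf (Φ₀ 0, Φ₀ 1))) -
              ∑ m ∈ Finset.range n₁, dartWnd (Φ₁ m, Φ₁ (m + 1)) (rf (Φ₀ 0, Φ₀ 1)))) := by
  have h4₀ := hT₀.four_le_length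
  have h4₁ := hT₁.four_le_length
  simp only [List.length_map, List.length_range] at h4₀ h4₁
  -- the first dart is a dart of both trails
  have hd₀ : (Φ₀ 0, Φ₀ 1) ∈ cdarts ((List.range (n₀ + L)).map Φ₀) := by
    rw [cdarts_map_range Φ₀ hper₀, List.mem_map]
    exact ⟨0, List.mem_range.2 (by omega), rfl⟩
  have hd₁ : (Φ₀ 0, Φ₀ 1) ∈ cdarts ((List.range (n₁ + L)).map Φ₁) := by
    rw [cdarts_map_range Φ₁ hper₁, List.mem_map, h0, h1]
    exact ⟨0, List.mem_range.2 (by omega), rfl⟩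
  have e₀ := cturn_eq_four_mul_wnd_SR hT₀ hd₀
  have e₁ := cturn_eq_four_mul_wnd_SR hT₁ hd₁
  rw [cturn_map_range Φ₀ (by omega) hper₀ hper₀', wnd_map_range_SR Φ₀ hper₀,
    wnd_map_range_SR Φ₀ hper₀] at e₀
  rw [cturn_map_range Φ₁ (by omega) hper₁ hper₁', wnd_map_range_SR Φ₁ hper₁,
    wnd_map_range_SR Φ₁ hper₁] at e₁
  rw [Finset.sum_range_add, Finset.sum_range_add, Finset.sum_range_add] at e₀ e₁
  -- the tails agree termwise
  have tt : ∑ u ∈ Finset.range L, turn (Φ₀ (n₀ + u)) (Φ₀ (n₀ + u + 1)) (Φ₀ (n₀ + u + 2)) =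
      ∑ u ∈ Finset.range L, turn (Φ₁ (n₁ + u)) (Φ₁ (n₁ + u + 1)) (Φ₁ (n₁ + u + 2)) := by
    refine Finset.sum_congr rfl fun u hu => ?_
    rw [Finset.mem_range] at hu
    rw [htail u (by omega), add_assoc, htail (u + 1) (by omega), add_assoc n₀, htail (u + 2) (by omega)]
    rfl
  have tw : ∀ F, ∑ u ∈ Finset.range L, dartWnd (Φ₀ (n₀ + u), Φ₀ (n₀ + u + 1)) F =
      ∑ u ∈ Finset.range L, dartWnd (Φ₁ (n₁ + u), Φ₁ (n₁ + u + 1)) F := by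
    intro F
    refine Finset.sum_congr rfl fun u hu => ?_
    rw [Finset.mem_range] at hu
    rw [htail u (by omega), add_assoc, htail (u + 1) (by omega)]
    rfl
  rw [tt, tw, tw] at e₀
  linarith

/-! ## Closed dart chains: unit-or-null steps with zero boundary

A *closed dart chain* is a list `D` of steps with `∀ g, (D.map fun d => g d.2 - g d.1).sum = 0`
(Kirchhoff at every vertex set); the hypothesis is written inline. -/

/-- In a closed chain every head is a tail. -/
theorem exists_fst_eq_of_closedChain_SR {D : List (Pt × Pt)}
    (hK : ∀ g : Pt → ℤ, (D.map fun d => g d.2 - g d.1).sum = 0) {p : Pt}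
    (hp : ∃ d ∈ D, d.2 = p) : ∃ d ∈ D, d.1 = p := by
  by_contra hne
  push Not at hne
  have key := hK (fun q => if q = p then 1 else 0)
  have hsplit : ∀ D' : List (Pt × Pt), (∀ d ∈ D', d.1 ≠ p) →
      (D'.map fun d => (if d.2 = p then (1:ℤ) else 0) - (if d.1 = p then 1 else 0)).sum =
        (D'.filter fun d => d.2 = p).length := by
    intro D' hD'
    induction D' with
    | nil => simp
    | cons d D' ih =>
      simp only [List.map_cons, List.sum_cons, List.filter_cons]
      rw [ih (fun e he => hD' e (List.mem_cons_of_mem _ he)), if_neg (hD' d (by simp))]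
      by_cases h : d.2 = p
      · simp [h]; ring
      · simp [h]
  rw [hsplit D hne] at key
  obtain ⟨d, hd, hdp⟩ := hp
  have : d ∈ D.filter fun d => d.2 = p := List.mem_filter.2 ⟨hd, by simpa using hdp⟩
  have hlen : 0 < (D.filter fun d => d.2 = p).length := List.length_pos_of_mem this
  omega

/-- Per-step flux identity across a horizontal segment, for a unit or null step. -/
theorem step_flux_SR (d : Pt × Pt) (hd : IsUnitStep d.1 d.2 ∨ d.1 = d.2) (x y : ℤ) :
    rowInd x y d.2 - rowInd x y d.1 = (dartWnd d (x, y) - dartWnd d (x, y - 1)) -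
      (if d = ((x, y), (x + 1, y)) then 1 else 0) + (if d = ((x + 1, y), (x, y)) then 1 else 0) := by
  rcases hd with hd | hd
  · exact unitStep_flux d hd x y
  · obtain ⟨⟨a, b⟩, ⟨c, e⟩⟩ := d
    simp only [Prod.mk.injEq] at hd
    obtain ⟨rfl, rfl⟩ := hd
    simp only [dartWnd, rowInd, Prod.mk.injEq]
    split_ifs <;> omega

/-- **Jump across a horizontal segment** for a closed chain of unit-or-null steps. -/
theorem dwnd_sub_south_chain_SR (D : List (Pt × Pt)) (hD : ∀ d ∈ D, IsUnitStep d.1 d.2 ∨ d.1 = d.2)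
    (hK : ∀ g : Pt → ℤ, (D.map fun d => g d.2 - g d.1).sum = 0) (x y : ℤ) :
    dwnd D (x, y) - dwnd D (x, y - 1) = D.count ((x, y), (x + 1, y)) - D.count ((x + 1, y), (x, y)) := by
  have main : ∀ D' : List (Pt × Pt), (∀ d ∈ D', IsUnitStep d.1 d.2 ∨ d.1 = d.2) →
      dwnd D' (x, y) - dwnd D' (x, y - 1) = D'.count ((x, y), (x + 1, y)) - D'.count ((x + 1, y), (x, y)) +
        (D'.map fun d => rowInd x y d.2 - rowInd x y d.1).sum := by
    intro D' hD'
    induction D' with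
    | nil => simp
    | cons d D' ih =>
      simp only [dwnd_cons, List.count_cons, beq_iff_eq, List.map_cons, List.sum_cons]
      have h1 := step_flux_SR d (hD' d (by simp)) x y
      have h2 := ih (fun e he => hD' e (by simp [he]))
      push_cast
      omega
  have := main D hD
  rw [hK (rowInd x y), add_zero] at this
  exact this

/-- Bounds for the second coordinates of all endpoints of a dart list. -/
theorem exists_snd_bounds_SR (D : List (Pt × Pt)) :
    ∃ m : ℤ, ∀ d ∈ D, (d.1.2 ≤ m ∧ d.2.2 ≤ m) ∧ (-m ≤ d.1.2 ∧ -m ≤ d.2.2) := by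
  obtain ⟨m₁, hm₁⟩ := exists_upper_bounds (D.map Prod.fst ++ D.map Prod.snd)
  obtain ⟨m₂, hm₂⟩ := exists_lower_bounds (D.map Prod.fst ++ D.map Prod.snd)
  refine ⟨max m₁ (-m₂), fun d hd => ?_⟩
  have a1 : d.1 ∈ D.map Prod.fst ++ D.map Prod.snd := List.mem_append_left _ (List.mem_map.2 ⟨d, hd, rfl⟩)
  have a2 : d.2 ∈ D.map Prod.fst ++ D.map Prod.snd := List.mem_append_right _ (List.mem_map.2 ⟨d, hd, rfl⟩)
  have := hm₁ _ a1; have := hm₁ _ a2; have := hm₂ _ a1; have := hm₂ _ a2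
  refine ⟨⟨?_, ?_⟩, ?_, ?_⟩ <;> omega

/-- Northward sweep: if no step of the closed chain lies on the segments `(F.1, y') — (F.1 + 1, y')`,
`y' ≥ F.2 + 1`, then `dwnd D F = 0`. -/
theorem dwnd_eq_zero_of_north_free_SR (D : List (Pt × Pt)) (hD : ∀ d ∈ D, IsUnitStep d.1 d.2 ∨ d.1 = d.2)
    (hK : ∀ g : Pt → ℤ, (D.map fun d => g d.2 - g d.1).sum = 0) (F : Pt)
    (hfree : ∀ y' : ℤ, F.2 + 1 ≤ y' → ((F.1, y'), (F.1 + 1, y')) ∉ D ∧ ((F.1 + 1, y'), (F.1, y')) ∉ D) :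
    dwnd D F = 0 := by
  have step : ∀ k : ℕ, dwnd D (F.1, F.2 + (k + 1 : ℕ)) = dwnd D (F.1, F.2 + k) := by
    intro k
    have hj := dwnd_sub_south_chain_SR D hD hK F.1 (F.2 + (k + 1 : ℕ))
    obtain ⟨n1, n2⟩ := hfree (F.2 + (k + 1 : ℕ)) (by push_cast; omega)
    rw [List.count_eq_zero_of_not_mem n1, List.count_eq_zero_of_not_mem n2] at hj
    have e : F.2 + ((k + 1 : ℕ) : ℤ) - 1 = F.2 + k := by push_cast; ring
    rw [e] at hj
    omega
  have desc : ∀ k : ℕ, dwnd D (F.1, F.2 + k) = dwnd D F := by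
    intro k
    induction k with
    | zero => simp
    | succ k ih => rw [step, ih]
  obtain ⟨m, hm⟩ := exists_snd_bounds_SR D
  rw [← desc (m - F.2).toNat, dwnd, List.sum_eq_zero]
  intro a ha
  rw [List.mem_map] at ha
  obtain ⟨d, hd, rfl⟩ := ha
  have := (hm d hd).1
  exact dartWnd_eq_zero_of_le d _ (by simp; omega) (by simp; omega)

/-- Southward sweep: if no step of the closed chain lies on the segments `(F.1, y') — (F.1 + 1, y')`,
`y' ≤ F.2`, then `dwnd D F = 0`. -/
theorem dwnd_eq_zero_of_south_free_SR (D : List (Pt × Pt)) (hD : ∀ d ∈ D, IsUnitStep d.1 d.2 ∨ d.1 = d.2)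
    (hK : ∀ g : Pt → ℤ, (D.map fun d => g d.2 - g d.1).sum = 0) (F : Pt)
    (hfree : ∀ y' : ℤ, y' ≤ F.2 → ((F.1, y'), (F.1 + 1, y')) ∉ D ∧ ((F.1 + 1, y'), (F.1, y')) ∉ D) :
    dwnd D F = 0 := by
  have step : ∀ k : ℕ, dwnd D (F.1, F.2 - (k + 1 : ℕ)) = dwnd D (F.1, F.2 - k) := by
    intro k
    have hj := dwnd_sub_south_chain_SR D hD hK F.1 (F.2 - k)
    obtain ⟨n1, n2⟩ := hfree (F.2 - k) (by omega)
    rw [List.count_eq_zero_of_not_mem n1, List.count_eq_zero_of_not_mem n2] at hj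
    have e : F.2 - (k : ℤ) - 1 = F.2 - ((k + 1 : ℕ) : ℤ) := by push_cast; ring
    rw [e] at hj
    omega
  have desc : ∀ k : ℕ, dwnd D (F.1, F.2 - k) = dwnd D F := by
    intro k
    induction k with
    | zero => simp
    | succ k ih => rw [step, ih]
  obtain ⟨m, hm⟩ := exists_snd_bounds_SR D
  rw [← desc (m + F.2 + 1).toNat, dwnd, List.sum_eq_zero]
  intro a ha
  rw [List.mem_map] at ha
  obtain ⟨d, hd, rfl⟩ := ha
  have := (hm d hd).2
  exact dartWnd_eq_zero_of_gt d _ (by simp; omega) (by simp; omega)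

/-- **Quadrant lemma, north-east.** If no tail of the closed chain lies in the closed lattice quadrant
`{x ≥ F.1 + 1, y ≥ F.2 + 1}` (the points weakly north-east of the north-east corner of the face `F`),
the chain does not wind around `F`. -/
theorem dwnd_eq_zero_of_NE_SR (D : List (Pt × Pt)) (hD : ∀ d ∈ D, IsUnitStep d.1 d.2 ∨ d.1 = d.2)
    (hK : ∀ g : Pt → ℤ, (D.map fun d => g d.2 - g d.1).sum = 0) (F : Pt) (hno : ∀ d ∈ D, ¬ (F.1 + 1 ≤ d.1.1 ∧ F.2 + 1 ≤ d.1.2)) :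
    dwnd D F = 0 := by
  refine dwnd_eq_zero_of_north_free_SR D hD hK F fun y' hy' => ⟨fun hm => ?_, fun hm => ?_⟩
  · obtain ⟨d, hd, hd1⟩ := exists_fst_eq_of_closedChain_SR hK ⟨_, hm, rfl⟩
    exact hno d hd (by rw [hd1]; exact ⟨le_rfl, hy'⟩)
  · exact hno _ hm ⟨le_rfl, hy'⟩

/-- **Quadrant lemma, north-west** (quadrant `{x ≤ F.1, y ≥ F.2 + 1}`). -/
theorem dwnd_eq_zero_of_NW_SR (D : List (Pt × Pt)) (hD : ∀ d ∈ D, IsUnitStep d.1 d.2 ∨ d.1 = d.2)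
    (hK : ∀ g : Pt → ℤ, (D.map fun d => g d.2 - g d.1).sum = 0) (F : Pt) (hno : ∀ d ∈ D, ¬ (d.1.1 ≤ F.1 ∧ F.2 + 1 ≤ d.1.2)) :
    dwnd D F = 0 := by
  refine dwnd_eq_zero_of_north_free_SR D hD hK F fun y' hy' => ⟨fun hm => ?_, fun hm => ?_⟩
  · exact hno _ hm ⟨le_rfl, hy'⟩
  · obtain ⟨d, hd, hd1⟩ := exists_fst_eq_of_closedChain_SR hK ⟨_, hm, rfl⟩
    exact hno d hd (by rw [hd1]; exact ⟨le_rfl, hy'⟩)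

/-- **Quadrant lemma, south-west** (quadrant `{x ≤ F.1, y ≤ F.2}`). -/
theorem dwnd_eq_zero_of_SW_SR (D : List (Pt × Pt)) (hD : ∀ d ∈ D, IsUnitStep d.1 d.2 ∨ d.1 = d.2)
    (hK : ∀ g : Pt → ℤ, (D.map fun d => g d.2 - g d.1).sum = 0) (F : Pt) (hno : ∀ d ∈ D, ¬ (d.1.1 ≤ F.1 ∧ d.1.2 ≤ F.2)) :
    dwnd D F = 0 := by
  refine dwnd_eq_zero_of_south_free_SR D hD hK F fun y' hy' => ⟨fun hm => ?_, fun hm => ?_⟩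
  · exact hno _ hm ⟨le_rfl, hy'⟩
  · obtain ⟨d, hd, hd1⟩ := exists_fst_eq_of_closedChain_SR hK ⟨_, hm, rfl⟩
    exact hno d hd (by rw [hd1]; exact ⟨le_rfl, hy'⟩)

/-- **Quadrant lemma, south-east** (quadrant `{x ≥ F.1 + 1, y ≤ F.2}`). -/
theorem dwnd_eq_zero_of_SE_SR (D : List (Pt × Pt)) (hD : ∀ d ∈ D, IsUnitStep d.1 d.2 ∨ d.1 = d.2)
    (hK : ∀ g : Pt → ℤ, (D.map fun d => g d.2 - g d.1).sum = 0) (F : Pt) (hno : ∀ d ∈ D, ¬ (F.1 + 1 ≤ d.1.1 ∧ d.1.2 ≤ F.2)) :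
    dwnd D F = 0 := by
  refine dwnd_eq_zero_of_south_free_SR D hD hK F fun y' hy' => ⟨fun hm => ?_, fun hm => ?_⟩
  · obtain ⟨d, hd, hd1⟩ := exists_fst_eq_of_closedChain_SR hK ⟨_, hm, rfl⟩
    exact hno d hd (by rw [hd1]; exact ⟨le_rfl, hy'⟩)
  · exact hno _ hm ⟨le_rfl, hy'⟩

/-- **Quadrant lemma** (registered anchor of this file): a closed chain of unit-or-null steps with
nonzero winding number around the face `F` has a tail in each of the four closed lattice quadrants at
`F` — north-east `{x ≥ F.1 + 1, y ≥ F.2 + 1}`, north-west `{x ≤ F.1, y ≥ F.2 + 1}`, south-west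
`{x ≤ F.1, y ≤ F.2}`, south-east `{x ≥ F.1 + 1, y ≤ F.2}`; in particular the centre of `F` lies in
the convex hull of the vertices. -/
theorem closedChain_quadrants_SR : ∀ (D : List (MedialTrail.Pt × MedialTrail.Pt)) (F : MedialTrail.Pt), (∀ d ∈ D, MedialTrail.IsUnitStep d.1 d.2 ∨ d.1 = d.2) → (∀ g : MedialTrail.Pt → ℤ, (D.map fun d => g d.2 - g d.1).sum = 0) → MedialTrail.dwnd D F ≠ 0 → (∃ d ∈ D, F.1 + 1 ≤ d.1.1 ∧ F.2 + 1 ≤ d.1.2) ∧ (∃ d ∈ D, d.1.1 ≤ F.1 ∧ F.2 + 1 ≤ d.1.2) ∧ (∃ d ∈ D, d.1.1 ≤ F.1 ∧ d.1.2 ≤ F.2) ∧ (∃ d ∈ D, F.1 + 1 ≤ d.1.1 ∧ d.1.2 ≤ F.2) := by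
  intro D F hD hK hw
  refine ⟨?_, ?_, ?_, ?_⟩ <;> by_contra h <;> push Not at h
  · exact hw (dwnd_eq_zero_of_NE_SR D hD hK F fun d hd hh => (h d hd hh.1).not_ge hh.2)
  · exact hw (dwnd_eq_zero_of_NW_SR D hD hK F fun d hd hh => (h d hd hh.1).not_ge hh.2)
  · exact hw (dwnd_eq_zero_of_SW_SR D hD hK F fun d hd hh => (h d hd hh.1).not_ge hh.2)
  · exact hw (dwnd_eq_zero_of_SE_SR D hD hK F fun d hd hh => (h d hd hh.1).not_ge hh.2)

end Summit.CriticalPhenomena.CardyFormulaZ2.Cruxes.EdgePrecompact.QkzStripBoundaryArm
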